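import Literature.NumberTheory.Transcendental.EllIterRep
import Literature.NumberTheory.Transcendental.KZUnfolding
import HarnessLib

/-!
# Genus-one iterated integrals: path reversal as a move of the KZ calculus; words of length 0, 1

Companion (API) file of `EllIterRep.lean` (`KZ.ellIterRep`, definition request `defn-ellIterRep`
of route KontsevichZagierPeriods/GenusOneIterated, items `stmt-KontsevichZagierPeriods-7185`,
`-7187`). That file constructs the representation `KZ.ellIterRep γ w hw : KZ.IntegralRep n` of the
iterated integral `∫_γ φ₀ ⋯ φ_{n−1}` along a monotone arc `γ` of the real oval of
`y² = 4(x − e₁)(x − e₂)(x − e₃)` and proves the *pointwise* content of path reversal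
(`KZ.mem_ellDomain_reverse_iff`, `KZ.ellIntegrand_reverse`). Here this is promoted to the
statements provers use, inside the Kontsevich–Zagier calculus of `KZCalculus.lean`:

* `KZ.ellIterRep_reverse_eq_reindex`, `KZ.ellIterRep_reverse_eq_neg_reindex` — ON THE NOSE,
  the representation of `∫_{γ⁻¹} φ₀ ⋯ φ_{n−1}` is the coordinate reversal
  (`KZ.IntegralRep.reindex · Fin.revPerm`) of the representation of `∫_γ φ_{n−1} ⋯ φ₀`, resp. of
  its negative (`KZ.IntegralRep.neg`) when `n` is odd;
* `KZ.of_ellIterRep_reverse_sub_mem_relations` — **path reversal is a relation of the KZ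
  calculus**: `[∫_{γ⁻¹} φ₀ ⋯ φ_{n−1}] − (−1)ⁿ • [∫_γ φ_{n−1} ⋯ φ₀] ∈ KZ.relations`, by ONE change
  of variables (Kontsevich–Zagier's rule (2)) along `x ↦ x ∘ Fin.rev`
  (`KZ.of_sub_of_reindex_mem_relations`) and, for odd `n`, the antisymmetric junk
  `[σ, f] + [σ, −f] ∈ relations` (rule (1b), `KZ.of_add_of_neg_mem_levelRel`);
* `KZ.ellIterRep_reverse_equivalent`, `KZ.ellIterRep_reverse_equivalent_neg` — the same as
  `KZ.Equivalent` statements (`∫_{γ⁻¹} w ~ ∫_γ w^rev` for even `n`, `~ (∫_γ w^rev).neg` for odd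
  `n`), the form in which route items are phrased;
* `KZ.ellIterRep_reverse_value` — hence `∫_{γ⁻¹} φ₀ ⋯ φ_{n−1} = (−1)ⁿ ∫_γ φ_{n−1} ⋯ φ₀`
  (Goncharov 2005, Prop. 2.1; Chen 1977, §1.6 for the inverse plot `α⁻¹`) by soundness of the
  calculus (`KZ.relations_le_ker_eval_holds`);
* `KZ.ellIterRep_value_of_zero` — the empty word: `∫_γ ∅ = 1` (Chen 1977, §1.1, "when `r = 0`,
  set the integral to be `1`"), a theorem here since the domain is the one-point space `ℝ⁰`;
* `KZ.ellIterRep_value_of_one` — a single letter: `∫_γ φ = σ ∫_{(lo, hi)} φ(x) dx`, the ordinary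
  abelian integral of the first/second/third kind over the `x`-range of the arc with its
  orientation sign (Chen 1977, §1.1 (1.1.1) with `r = 1`; Lawden 1989, §6.12–§6.14 for these
  integrals over `(e₃, e₂)`).

## References

* A. B. Goncharov, *Galois symmetries of fundamental groupoids and noncommutative geometry*,
  Duke Math. J. 128 (2005) (arXiv:math/0208144), §2: the relations i) (unit,
  `𝕀(a; ∅; b) = 1`), ii) (shuffle), iii) (path composition) of formal iterated integrals and
  Prop. 2.1 (reversal, `𝕀(a₀; a₁, …, a_m; a_{m+1}) = (−1)^m 𝕀(a_{m+1}; a_m, …, a₁; a₀)`,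
  derived from i)–iii)). [Goncharov2005]
* K.-T. Chen, *Iterated path integrals*, Bull. Amer. Math. Soc. 83 (1977), 831–879: §1.1
  (1.1.1), p. 833 (iterated line integrals by induction, last letter outermost; "When `r = 0`,
  set the integral to be `1`"), §1.6, p. 843 (the inverse plot `α⁻¹(ξ)(t) = α(ξ)(1 − t)` and
  the product formulas (1.6.1)–(1.6.3)). [Chen1977]
* M. Kontsevich, D. Zagier, *Periods* (2001), §1.2, rules (1)–(2). [KontsevichZagier2001]
* D. F. Lawden, *Elliptic Functions and Applications* (1989), §6.12–§6.14 (the real integrals of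
  the three kinds over `(e₃, e₂)`). [Lawden1989]
-/

open MeasureTheory Set

namespace Literature.NumberTheory.Transcendental

namespace KZ

variable {E : EllCurve} {n : ℕ}

/-! ### Path reversal -/

/-- **Reversal, even length, on the nose**: for even `n` the representation of
`∫_{γ⁻¹} φ₀ ⋯ φ_{n−1}` IS the coordinate reversal `x ↦ x ∘ Fin.rev` (`IntegralRep.reindex` along
`Fin.revPerm`) of the representation of `∫_γ φ_{n−1} ⋯ φ₀` — same domain up to reversing the
coordinates, same integrand since `(−1)ⁿ = 1`.
[Goncharov 2005, Prop. 2.1; Chen 1977, §1.6] [cite: Goncharov2005, Prop. 2.1] -/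
theorem ellIterRep_reverse_eq_reindex (γ : EllArc E) (w : Fin n → EllLetter)
    (hw : γ.reverse.Adapted w) (hw' : γ.Adapted (w ∘ Fin.rev)) (hn : Even n) :
    ellIterRep γ.reverse w hw = (ellIterRep γ (w ∘ Fin.rev) hw').reindex Fin.revPerm := by
  apply IntegralRep.ext'
  · ext x
    simp only [ellIterRep_domain, IntegralRep.reindex_domain, Fin.revPerm_apply, mem_setOf_eq,
      mem_ellDomain_reverse_iff]
    rfl
  · funext x
    simp only [ellIterRep_integrand, IntegralRep.reindex_integrand, Fin.revPerm_apply,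
      ellIntegrand_reverse, hn.neg_one_pow, one_mul]
    rfl

/-- **Reversal, odd length, on the nose**: for odd `n` the representation of
`∫_{γ⁻¹} φ₀ ⋯ φ_{n−1}` is the NEGATIVE (`IntegralRep.neg`: same domain, opposite integrand) of
the coordinate reversal of the representation of `∫_γ φ_{n−1} ⋯ φ₀`, since `(−1)ⁿ = −1`.
[Goncharov 2005, Prop. 2.1; Chen 1977, §1.6] [cite: Goncharov2005, Prop. 2.1] -/
theorem ellIterRep_reverse_eq_neg_reindex (γ : EllArc E) (w : Fin n → EllLetter)
    (hw : γ.reverse.Adapted w) (hw' : γ.Adapted (w ∘ Fin.rev)) (hn : Odd n) :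
    ellIterRep γ.reverse w hw = ((ellIterRep γ (w ∘ Fin.rev) hw').reindex Fin.revPerm).neg := by
  apply IntegralRep.ext'
  · ext x
    simp only [ellIterRep_domain, IntegralRep.domain_neg, IntegralRep.reindex_domain,
      Fin.revPerm_apply, mem_setOf_eq, mem_ellDomain_reverse_iff]
    rfl
  · funext x
    simp only [ellIterRep_integrand, IntegralRep.integrand_neg, IntegralRep.reindex_integrand,
      Fin.revPerm_apply, Pi.neg_apply, ellIntegrand_reverse, hn.neg_one_pow, neg_one_mul]
    rfl

/-- **Path reversal is a relation of the KZ calculus**: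
`[∫_{γ⁻¹} φ₀ ⋯ φ_{n−1}] − (−1)ⁿ • [∫_γ φ_{n−1} ⋯ φ₀] ∈ KZ.relations` — one change of variables
(Kontsevich–Zagier's rule (2)) along the coordinate reversal `x ↦ x ∘ Fin.rev`, a linear map with
`|det| = 1` (`of_sub_of_reindex_mem_relations`), and for odd `n` the rule-(1b) cancellation
`[σ, f] + [σ, −f] ∈ relations` (`of_add_of_neg_mem_levelRel`). The two adaptedness proofs are
interchangeable data (`EllArc.adapted_reverse_iff`, `EllArc.Adapted.comp_rev`).
[Goncharov 2005, Prop. 2.1; Kontsevich–Zagier 2001, §1.2 rules (1)–(2)]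
[cite: Goncharov2005, Prop. 2.1] -/
theorem of_ellIterRep_reverse_sub_mem_relations (γ : EllArc E) (w : Fin n → EllLetter)
    (hw : γ.reverse.Adapted w) (hw' : γ.Adapted (w ∘ Fin.rev)) :
    of (ellIterRep γ.reverse w hw) - ((-1 : ℤ) ^ n) • of (ellIterRep γ (w ∘ Fin.rev) hw') ∈
      relations := by
  set r := ellIterRep γ (w ∘ Fin.rev) hw' with hr
  have hre : of r - of (r.reindex Fin.revPerm) ∈ relations :=
    of_sub_of_reindex_mem_relations r Fin.revPerm
  rcases Nat.even_or_odd n with hn | hn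
  · rw [ellIterRep_reverse_eq_reindex γ w hw hw' hn, hn.neg_one_pow, one_zsmul, ← hr, ← neg_sub]
    exact relations.neg_mem hre
  · rw [ellIterRep_reverse_eq_neg_reindex γ w hw hw' hn, hn.neg_one_pow, neg_one_zsmul, ← hr,
      sub_neg_eq_add]
    have hjunk : of (r.reindex Fin.revPerm) + of (r.reindex Fin.revPerm).neg ∈ relations :=
      levelRel_le_relations (of_add_of_neg_mem_levelRel _)
    have key : of (r.reindex Fin.revPerm).neg + of r =
        of (r.reindex Fin.revPerm) + of (r.reindex Fin.revPerm).neg +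
          (of r - of (r.reindex Fin.revPerm)) := by
      abel
    rw [key]
    exact relations.add_mem hjunk hre

/-- Path reversal as a relation, with the adaptedness of the reversed word derived from that of
`w` (convenience form of `of_ellIterRep_reverse_sub_mem_relations`). [Goncharov 2005, Prop. 2.1]
[cite: Goncharov2005, Prop. 2.1] -/
theorem of_ellIterRep_reverse_sub_mem_relations' (γ : EllArc E) (w : Fin n → EllLetter)
    (hw : γ.reverse.Adapted w) :
    of (ellIterRep γ.reverse w hw) -
        ((-1 : ℤ) ^ n) • of (ellIterRep γ (w ∘ Fin.rev)
          ((γ.adapted_reverse_iff w).1 hw).comp_rev) ∈ relations :=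
  of_ellIterRep_reverse_sub_mem_relations γ w hw _

/-- **Path reversal as an equivalence, even length**: for even `n`,
`∫_{γ⁻¹} φ₀ ⋯ φ_{n−1} ~ ∫_γ φ_{n−1} ⋯ φ₀` in the KZ calculus (one coordinate reversal).
[Goncharov 2005, Prop. 2.1; Kontsevich–Zagier 2001, §1.2 rule (2)]
[cite: Goncharov2005, Prop. 2.1] -/
theorem ellIterRep_reverse_equivalent (γ : EllArc E) (w : Fin n → EllLetter)
    (hw : γ.reverse.Adapted w) (hw' : γ.Adapted (w ∘ Fin.rev)) (hn : Even n) :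
    Equivalent (ellIterRep γ.reverse w hw) (ellIterRep γ (w ∘ Fin.rev) hw') := by
  rw [ellIterRep_reverse_eq_reindex γ w hw hw' hn]
  show of _ - of _ ∈ relations
  rw [← neg_sub]
  exact relations.neg_mem
    (of_sub_of_reindex_mem_relations (ellIterRep γ (w ∘ Fin.rev) hw') Fin.revPerm)

/-- **Path reversal as an equivalence, odd length**: for odd `n`,
`∫_{γ⁻¹} φ₀ ⋯ φ_{n−1} ~ −∫_γ φ_{n−1} ⋯ φ₀` in the KZ calculus, the right-hand side realised by
the negative representation `IntegralRep.neg` (one coordinate reversal and two rule-(1b)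
cancellations `[σ, f] + [σ, −f] ∈ relations`).
[Goncharov 2005, Prop. 2.1; Kontsevich–Zagier 2001, §1.2 rules (1)–(2)]
[cite: Goncharov2005, Prop. 2.1] -/
theorem ellIterRep_reverse_equivalent_neg (γ : EllArc E) (w : Fin n → EllLetter)
    (hw : γ.reverse.Adapted w) (hw' : γ.Adapted (w ∘ Fin.rev)) (hn : Odd n) :
    Equivalent (ellIterRep γ.reverse w hw) (ellIterRep γ (w ∘ Fin.rev) hw').neg := by
  rw [ellIterRep_reverse_eq_neg_reindex γ w hw hw' hn]
  set r := ellIterRep γ (w ∘ Fin.rev) hw' with hr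
  have hre : of r - of (r.reindex Fin.revPerm) ∈ relations :=
    of_sub_of_reindex_mem_relations r Fin.revPerm
  have h₁ : of (r.reindex Fin.revPerm) + of (r.reindex Fin.revPerm).neg ∈ relations :=
    levelRel_le_relations (of_add_of_neg_mem_levelRel _)
  have h₂ : of r + of r.neg ∈ relations := levelRel_le_relations (of_add_of_neg_mem_levelRel _)
  have key : of (r.reindex Fin.revPerm).neg - of r.neg =
      of (r.reindex Fin.revPerm) + of (r.reindex Fin.revPerm).neg - (of r + of r.neg) +
        (of r - of (r.reindex Fin.revPerm)) := by
    abel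
  show of (r.reindex Fin.revPerm).neg - of r.neg ∈ relations
  rw [key]
  exact relations.add_mem (relations.sub_mem h₁ h₂) hre

/-- **Path reversal for the values**: `∫_{γ⁻¹} φ₀ ⋯ φ_{n−1} = (−1)ⁿ ∫_γ φ_{n−1} ⋯ φ₀`
(soundness of the KZ calculus applied to `of_ellIterRep_reverse_sub_mem_relations`).
[Goncharov 2005, Prop. 2.1; Chen 1977, §1.6] [cite: Goncharov2005, Prop. 2.1] -/
theorem ellIterRep_reverse_value (γ : EllArc E) (w : Fin n → EllLetter)
    (hw : γ.reverse.Adapted w) (hw' : γ.Adapted (w ∘ Fin.rev)) :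
    (ellIterRep γ.reverse w hw).value = (-1) ^ n * (ellIterRep γ (w ∘ Fin.rev) hw').value := by
  have h := relations_le_ker_eval_holds (of_ellIterRep_reverse_sub_mem_relations γ w hw hw')
  rw [AddMonoidHom.mem_ker, map_sub, map_zsmul, eval_of, eval_of, sub_eq_zero] at h
  rw [h, zsmul_eq_mul]
  push_cast
  ring

/-- **Reversing twice**: the word-and-arc data of `(γ⁻¹)⁻¹` with `(w^rev)^rev` is that of `γ`
with `w`, so the representations agree (`α⁻¹(t) = α(1 − t)` is an involution).
[Chen 1977, §1.6, p. 843] [folklore] -/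
theorem ellIterRep_reverse_reverse (γ : EllArc E) (w : Fin n → EllLetter)
    (hw : γ.reverse.reverse.Adapted ((w ∘ Fin.rev) ∘ Fin.rev)) (hw' : γ.Adapted w) :
    ellIterRep γ.reverse.reverse ((w ∘ Fin.rev) ∘ Fin.rev) hw = ellIterRep γ w hw' := by
  apply IntegralRep.ext'
  · simp
  · simp only [ellIterRep_integrand, EllArc.reverse_reverse]
    congr 1
    funext k
    simp

/-! ### Words of length `0` and `1` -/

/-- In dimension `0` the domain of every arc is the one-point space `ℝ⁰`. [Chen 1977, §1.1]
[folklore] -/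
theorem ellDomain_zero (γ : EllArc E) : ellDomain γ 0 = univ := by
  ext x
  simp only [mem_ellDomain_iff, IsEmpty.forall_iff, true_and, mem_univ, iff_true]
  cases γ.forward
  · exact fun i => i.elim0
  · exact fun i => i.elim0

/-- In dimension `0` the integrand is the constant `1` (empty product). [Chen 1977, §1.1]
[folklore] -/
theorem ellIntegrand_zero (γ : EllArc E) (w : Fin 0 → EllLetter) (x : Fin 0 → ℝ) :
    ellIntegrand γ w x = 1 := by
  simp [ellIntegrand]

/-- **The empty word**: `∫_γ ∅ = 1` — Chen's convention "when `r = 0`, set the integral to be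
`1`" is a theorem for `ellIterRep`: the value is the integral of `1` over the one-point space
`ℝ⁰` of mass `1`. [Chen 1977, §1.1 (1.1.1)] [cite: Chen1977, §1.1 (1.1.1)] -/
theorem ellIterRep_value_of_zero (γ : EllArc E) (w : Fin 0 → EllLetter) (hw : γ.Adapted w) :
    (ellIterRep γ w hw).value = 1 := by
  rw [ellIterRep_value, ellDomain_zero, Measure.restrict_univ]
  simp only [ellIntegrand_zero, integral_const, smul_eq_mul, mul_one]
  rw [measureReal_def, volume_pi, Measure.pi_univ]
  simp

/-- In dimension `1` the domain of an arc is the open `x`-range `(lo, hi)` read in the single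
coordinate (the monotonicity condition is vacuous). [Chen 1977, §1.1] [folklore] -/
theorem mem_ellDomain_one_iff (γ : EllArc E) (x : Fin 1 → ℝ) :
    x ∈ ellDomain γ 1 ↔ x 0 ∈ Ioo γ.lo γ.hi := by
  have hm : StrictMono x := fun a b hab => by
    rw [Subsingleton.elim a b] at hab; exact (lt_irrefl _ hab).elim
  have ha : StrictAnti x := fun a b hab => by
    rw [Subsingleton.elim a b] at hab; exact (lt_irrefl _ hab).elim
  simp only [mem_ellDomain_iff, Fin.forall_fin_one, mem_Ioo]
  cases γ.forward <;> simp [hm, ha]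

/-- In dimension `1` the integrand is `σ φ(x₀)`. [Chen 1977, §1.1] [folklore] -/
theorem ellIntegrand_one (γ : EllArc E) (w : Fin 1 → EllLetter) (x : Fin 1 → ℝ) :
    ellIntegrand γ w x = γ.orSign * (w 0).density γ (x 0) := by
  simp [ellIntegrand]

/-- **A single letter**: `∫_γ φ = σ ∫_{(lo, hi)} φ(x) dx` — the value of the length-one
representation is the ordinary (absolutely convergent) abelian integral of the letter over the
`x`-range of the arc, times the orientation sign `σ = ±1` (identify `ℝ¹` with `ℝ` by the
volume-preserving `MeasurableEquiv.funUnique`). For `γ` the upper half-oval and `φ = ω`, `η`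
these are the complete real integrals of the first and second kind over `(e₃, e₂)` of
Lawden 1989, §6.12–§6.13. [Chen 1977, §1.1 (1.1.1); Lawden 1989, §6.12 (6.12.25)]
[cite: Chen1977, §1.1 (1.1.1)] -/
theorem ellIterRep_value_of_one (γ : EllArc E) (w : Fin 1 → EllLetter) (hw : γ.Adapted w) :
    (ellIterRep γ w hw).value = γ.orSign * ∫ x in Ioo γ.lo γ.hi, (w 0).density γ x := by
  set e := MeasurableEquiv.funUnique (Fin 1) ℝ with he_def
  have he : MeasurePreserving e volume volume := volume_preserving_funUnique (Fin 1) ℝ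
  have happ : ∀ x : Fin 1 → ℝ, e x = x 0 := fun x => rfl
  have hdom : ellDomain γ 1 = e ⁻¹' Ioo γ.lo γ.hi := by
    ext x
    rw [mem_ellDomain_one_iff, mem_preimage, happ]
  calc (ellIterRep γ w hw).value
      = ∫ x in e ⁻¹' Ioo γ.lo γ.hi, (fun t => γ.orSign * (w 0).density γ t) (e x) := by
        rw [ellIterRep_value, hdom]
        simp only [ellIntegrand_one, happ]
    _ = ∫ t in Ioo γ.lo γ.hi, γ.orSign * (w 0).density γ t :=
        he.setIntegral_preimage_emb e.measurableEmbedding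
          (fun t => γ.orSign * (w 0).density γ t) (Ioo γ.lo γ.hi)
    _ = γ.orSign * ∫ t in Ioo γ.lo γ.hi, (w 0).density γ t := integral_const_mul _ _

end KZ

end Literature.NumberTheory.Transcendental
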